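import Literature.MathematicalPhysics.QuantumLattice.HubbardScaleReportCT
import Literature.MathematicalPhysics.QuantumLattice.MatsubaraTruncationMidpoint
import Literature.MathematicalPhysics.QuantumLattice.DWaveSourceFreePressure
import Literature.MathematicalPhysics.QuantumLattice.FinDimSpectrum
import Summits.HubbardSuperconductivity.HubbardSuperconductivity.Theorems.AposterioriOrderCriterionR.Negative.FreeCoupling
import Summits.HubbardSuperconductivity.HubbardSuperconductivity.Theorems.ThermalWedgeTwSourcedCondensationEngineSusceptibility
import Summits.HubbardSuperconductivity.HubbardSuperconductivity.Theorems.TwSourcedCondensation.Negative.StubCooperLogCorner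

/-!
# Crux `AposterioriOrderCriterionR` (item `stmt-HubbardSuperconductivity-13884`): the Matsubara bridge at `U = 0`

`--supports stmt-HubbardSuperconductivity-13884` helper of the line lead (seat c3); no definition, no `sorry`,
no named fact.  Every line of the crux crosses ONE Grassmann → operator transfer stub; the registered one
(`stub_matsubaraBridge`, skeleton grassmann-ward-flow) reads

  `Tendsto (fun M => scaleMeanFieldDensityCT L M β U μ h K' Λ') atTop`
  `  (𝓝 ((gibbsState β (dWaveSourceTorus L U μ h) (pairField dWaveFormFactor L)).re / L²))`.

For `U ≠ 0` it is false at the letter `μ` (X1: the Grassmann model at `μ` is the operator model at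
`μ + U/2`).  This file proves its **free instance `U = 0` in the bare frame `K' = 0`** — where the shift
vanishes — for every `L ≥ 3`, `β > 0`, `μ`, `h`, `Λ₀`:

* `scaleMeanFieldDensityCT_free_zero_frame` — closed form at finite `M`:
  `m₀ = (βL²)⁻¹ Σ_{ω,k} h φ_d(k)² / (ω² + ξ_k² + h²φ_d(k)²)` (`φ_d = dWaveSymbol = 2√2 ĝ_d`);
* `tendsto_scaleMeanFieldDensityCT_free_zero_frame` — `M → ∞`:
  `m₀ → L⁻² Σ_k h φ_d(k)² tanh(βE_k/2)/(2E_k)`, `E_k = √(ξ_k² + h²φ_d(k)²)` (truncated Matsubara sum,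
  `tendsto_sum_matsubaraIdx_one_div_sq_add_sq`);
* `re_gibbsState_pairField_free` — the operator side in closed form:
  `Re⟨Δ_d⟩_{β,h} = Σ_k 4hĝ_d(k)² tanh(βE_k/2)/E_k` (`d/dh log Z = β Re⟨Δ_d + Δ_d†⟩` and the BdG pressure
  `log_partitionFn_dWaveSourceTorus_zero_sub`, differentiated mode by mode; half-angle `sinh_div_one_add_cosh` of the tree);
* `tendsto_scaleMeanFieldDensityCT_free_bridge` — the bridge itself:
  `scaleMeanFieldDensityCT L M β 0 μ h 0 Λ₀ → Re⟨Δ_d⟩_{β, dWaveSourceTorus L 0 μ h}/L²`,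
  and `stub_matsubaraBridge_free_zero_frame`, the registered stub's shape at `U = 0`, `K' = 0`.

So at `U = 0` the report's `m₀` coordinate converges to EXACTLY the operator anomalous density: the seed
normalisation (`h φ_d` in the covariance vs `h(Δ_d + Δ_d†)` in the Hamiltonian), the factor `½`, the `L²`
and the Matsubara conventions of `HubbardScaleReportCT` / `DWaveSource` agree — the `μ`-shift X1 is the only
mismatch a restatement of the crux has to absorb (kernel-checked here at zero coupling).
-/

noncomputable section

namespace Summit.HubbardSuperconductivity.HubbardSuperconductivity.Theorems

open Literature.MathematicalPhysics.QuantumLattice Literature.Probability.LatticeModels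
open Summit.HubbardSuperconductivity.HubbardSuperconductivity.Theorems.AposterioriOrderCriterionR.Negative
open Summit.HubbardSuperconductivity.HubbardSuperconductivity.Theorems.TwSourcedCondensation.Negative
open Filter Finset Matrix
open scoped Topology

set_option linter.dupNamespace false

/-! ### Grassmann side: the free mean-field density at finite `M` -/

section Grassmann

variable (L M : ℕ) [NeZero L]

omit [NeZero L] in
/-- The free BCS denominator is positive (`β ≠ 0`: no Matsubara frequency vanishes). [folklore] -/
theorem nambuDen_pos {β : ℝ} (hβ : β ≠ 0) (μ h : ℝ) (k : FreqMomentum L M) : 0 < nambuDen L M β μ h k := by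
  have hω := matsubaraFreq_ne_zero (M := M) hβ k.1
  rw [nambuDen]
  have h1 : 0 < matsubaraFreq β M k.1 ^ 2 := by positivity
  nlinarith [sq_nonneg (nambuXi L μ k.2), sq_nonneg (h * dWaveSymbol L k.2)]

omit [NeZero L] in
/-- `d/dh log(ω² + ξ² + h²φ²) = 2hφ²/(ω² + ξ² + h²φ²)`. [folklore] -/
theorem hasDerivAt_log_nambuDen {β : ℝ} (hβ : β ≠ 0) (μ h : ℝ) (k : FreqMomentum L M) :
    HasDerivAt (fun h' => Real.log (nambuDen L M β μ h' k))
      (2 * h * dWaveSymbol L k.2 ^ 2 / nambuDen L M β μ h k) h := by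
  have hd : HasDerivAt (fun h' => nambuDen L M β μ h' k) (2 * h * dWaveSymbol L k.2 ^ 2) h := by
    have hf : (fun h' => nambuDen L M β μ h' k) =
        fun h' => (matsubaraFreq β M k.1 ^ 2 + nambuXi L μ k.2 ^ 2) + dWaveSymbol L k.2 ^ 2 * (h' * h') := by
      funext h'; rw [nambuDen]; ring
    rw [hf]
    refine ((((hasDerivAt_id' h).mul (hasDerivAt_id' h)).const_mul (dWaveSymbol L k.2 ^ 2)).const_add
      (matsubaraFreq β M k.1 ^ 2 + nambuXi L μ k.2 ^ 2)).congr_deriv ?_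
    ring
  exact hd.log (nambuDen_pos L M hβ μ h k).ne'

/-- **The free scale-`Λ₀` mean-field density in closed form** (`U = 0`, bare frame, any `Λ₀`):
`m₀ = (βL²)⁻¹ Σ_{ω,k} h φ_d(k)²/(ω² + ξ_k² + h²φ_d(k)²)` — the Matsubara-truncated free BdG anomalous
density. [folklore] -/
theorem scaleMeanFieldDensityCT_free_zero_frame {β : ℝ} (hβ : β ≠ 0) (μ h Λ₀ : ℝ) :
    scaleMeanFieldDensityCT L M β 0 μ h 0 Λ₀ =
      (1 / (β * (L : ℝ) ^ 2)) * ∑ k : FreqMomentum L M, h * dWaveSymbol L k.2 ^ 2 / nambuDen L M β μ h k := by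
  rw [scaleMeanFieldDensityCT_zero_frame, scaleMeanFieldDensity_free]
  have hsum : HasDerivAt (fun h' => -(1 / (β * (L : ℝ) ^ 2)) * freeLogDet L M β μ h' 0)
      (-(1 / (β * (L : ℝ) ^ 2)) * ∑ k : FreqMomentum L M, 2 * h * dWaveSymbol L k.2 ^ 2 / nambuDen L M β μ h k) h := by
    have h1 := (HasDerivAt.fun_sum (u := Finset.univ) fun k _ => hasDerivAt_log_nambuDen L M hβ μ h k).const_mul
      (-(1 / (β * (L : ℝ) ^ 2)))
    refine h1.congr_of_eventuallyEq (Eventually.of_forall fun h' => ?_)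
    simp only [freeLogDet_zero_twist]
  rw [hsum.deriv, Finset.mul_sum, Finset.mul_sum, Finset.mul_sum]
  refine Finset.sum_congr rfl fun k _ => ?_
  ring

/-- Regrouping the frequency–momentum sum mode by mode:
`Σ_{ω,k} hφ²/(ω² + ξ² + h²φ²) = Σ_k hφ_k² Σ_ω 1/(ω² + E_k²)`, `E_k² = ξ_k² + h²φ_k²`. [folklore] -/
theorem sum_freqMomentum_anomalous (β μ h : ℝ) :
    ∑ k : FreqMomentum L M, h * dWaveSymbol L k.2 ^ 2 / nambuDen L M β μ h k =
      ∑ p : TorusSite 2 L, h * dWaveSymbol L p ^ 2 *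
        ∑ i : MatsubaraIdx M, 1 / (matsubaraFreq β M i ^ 2 + (nambuXi L μ p ^ 2 + (h * dWaveSymbol L p) ^ 2)) := by
  rw [Fintype.sum_prod_type, Finset.sum_comm]
  refine Finset.sum_congr rfl fun p _ => ?_
  rw [Finset.mul_sum]
  refine Finset.sum_congr rfl fun i _ => ?_
  rw [nambuDen, add_assoc]
  ring

omit [NeZero L] in
/-- The quasiparticle energy `E_k = √(ξ_k² + h²φ_d(k)²)` of the free seeded torus (Grassmann
normalisation `φ_d = dWaveSymbol`). [folklore] -/
theorem bcsEnergy_sq_eq (μ h : ℝ) (p : TorusSite 2 L) :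
    Real.sqrt (nambuXi L μ p ^ 2 + (h * dWaveSymbol L p) ^ 2) ^ 2 = nambuXi L μ p ^ 2 + (h * dWaveSymbol L p) ^ 2 :=
  Real.sq_sqrt (by positivity)

omit [NeZero L] in
/-- Mode by mode: `hφ_k² Σ_ω 1/(ω² + E_k²) → hφ_k² · β tanh(βE_k/2)/(2E_k)` (the mode with `hφ_k = 0`
contributes `0` on both sides). [folklore] -/
theorem tendsto_mode_anomalous {β : ℝ} (hβ : 0 < β) (μ h : ℝ) (p : TorusSite 2 L) :
    Tendsto (fun M : ℕ => h * dWaveSymbol L p ^ 2 *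
        ∑ i : MatsubaraIdx M, 1 / (matsubaraFreq β M i ^ 2 + (nambuXi L μ p ^ 2 + (h * dWaveSymbol L p) ^ 2))) atTop
      (𝓝 (h * dWaveSymbol L p ^ 2 *
        (β * Real.tanh (β * Real.sqrt (nambuXi L μ p ^ 2 + (h * dWaveSymbol L p) ^ 2) / 2) /
          (2 * Real.sqrt (nambuXi L μ p ^ 2 + (h * dWaveSymbol L p) ^ 2))))) := by
  by_cases h0 : h * dWaveSymbol L p = 0
  · have hc : h * dWaveSymbol L p ^ 2 = 0 := by rw [pow_two, ← mul_assoc, h0, zero_mul]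
    simp only [hc, zero_mul]
    exact tendsto_const_nhds
  · set E := Real.sqrt (nambuXi L μ p ^ 2 + (h * dWaveSymbol L p) ^ 2) with hE
    have hEpos : 0 < E := Real.sqrt_pos.2 (by positivity)
    have hlim := tendsto_sum_matsubaraIdx_one_div_sq_add_sq hβ hEpos.ne'
    rw [hE, bcsEnergy_sq_eq] at hlim
    exact hlim.const_mul _

/-- **The free mean-field density converges as `M → ∞`** (`U = 0`, bare frame, `β > 0`):
`m₀ → L⁻² Σ_k hφ_d(k)² tanh(βE_k/2)/(2E_k)`. [folklore] -/
theorem tendsto_scaleMeanFieldDensityCT_free_zero_frame {β : ℝ} (hβ : 0 < β) (μ h Λ₀ : ℝ) :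
    Tendsto (fun M : ℕ => scaleMeanFieldDensityCT L M β 0 μ h 0 Λ₀) atTop
      (𝓝 ((1 / (L : ℝ) ^ 2) * ∑ p : TorusSite 2 L, h * dWaveSymbol L p ^ 2 *
        (Real.tanh (β * Real.sqrt (nambuXi L μ p ^ 2 + (h * dWaveSymbol L p) ^ 2) / 2) /
          (2 * Real.sqrt (nambuXi L μ p ^ 2 + (h * dWaveSymbol L p) ^ 2))))) := by
  have hβ0 : β ≠ 0 := hβ.ne'
  have hsum := (tendsto_finsetSum (Finset.univ) fun p _ => tendsto_mode_anomalous L hβ μ h p).const_mul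
    (1 / (β * (L : ℝ) ^ 2))
  have heq : (1 / (β * (L : ℝ) ^ 2)) * ∑ p : TorusSite 2 L, h * dWaveSymbol L p ^ 2 *
        (β * Real.tanh (β * Real.sqrt (nambuXi L μ p ^ 2 + (h * dWaveSymbol L p) ^ 2) / 2) /
          (2 * Real.sqrt (nambuXi L μ p ^ 2 + (h * dWaveSymbol L p) ^ 2))) =
      (1 / (L : ℝ) ^ 2) * ∑ p : TorusSite 2 L, h * dWaveSymbol L p ^ 2 *
        (Real.tanh (β * Real.sqrt (nambuXi L μ p ^ 2 + (h * dWaveSymbol L p) ^ 2) / 2) /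
          (2 * Real.sqrt (nambuXi L μ p ^ 2 + (h * dWaveSymbol L p) ^ 2))) := by
    rw [Finset.mul_sum, Finset.mul_sum]
    refine Finset.sum_congr rfl fun p _ => ?_
    field_simp
  rw [← heq]
  refine hsum.congr fun M => ?_
  rw [scaleMeanFieldDensityCT_free_zero_frame L M hβ0, sum_freqMomentum_anomalous]

end Grassmann

/-! ### Operator side: the free Gibbs anomalous density in closed form -/

section Operator

variable {L : ℕ} [NeZero L]

omit [NeZero L] in
/-- **Mode-by-mode derivative of the free sourced pressure** (`h ≠ 0`):
`d/dt log((1 + cosh βE(t))/2) = β tanh(βE/2) · 8ĝ²h/E` at `t = h`, `E(t) = √(ξ² + (2√2 t ĝ)²)` (for `ĝ = 0`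
the mode is constant and both sides vanish). [folklore] -/
theorem hasDerivAt_log_bdgMode (β ξ g : ℝ) {h : ℝ} (hh : h ≠ 0) :
    HasDerivAt (fun t : ℝ => Real.log ((1 + Real.cosh (β * Real.sqrt (ξ ^ 2 + (2 * Real.sqrt 2 * t * g) ^ 2))) / 2))
      (β * Real.tanh (β * Real.sqrt (ξ ^ 2 + (2 * Real.sqrt 2 * h * g) ^ 2) / 2) * (8 * g ^ 2 * h) /
        Real.sqrt (ξ ^ 2 + (2 * Real.sqrt 2 * h * g) ^ 2)) h := by
  by_cases hg : g = 0
  · subst hg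
    simp only [mul_zero, ne_eq, OfNat.ofNat_ne_zero, not_false_eq_true, zero_pow, add_zero, zero_mul, zero_div]
    exact hasDerivAt_const h _
  · have hs2 : Real.sqrt 2 * Real.sqrt 2 = 2 := Real.mul_self_sqrt (by norm_num)
    -- the inner quadratic `u(t) = ξ² + (2√2 t ĝ)²` and its derivative `16 ĝ² h`
    have hv : HasDerivAt (fun t : ℝ => 2 * Real.sqrt 2 * t * g) (2 * Real.sqrt 2 * g) h := by
      refine (((hasDerivAt_id' h).const_mul (2 * Real.sqrt 2)).mul_const g).congr_deriv ?_
      ring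
    have hu : HasDerivAt (fun t : ℝ => ξ ^ 2 + (2 * Real.sqrt 2 * t * g) ^ 2) (16 * g ^ 2 * h) h := by
      have hsq : (fun t : ℝ => ξ ^ 2 + (2 * Real.sqrt 2 * t * g) ^ 2) =
          fun t : ℝ => ξ ^ 2 + (2 * Real.sqrt 2 * t * g) * (2 * Real.sqrt 2 * t * g) := by
        funext t; ring
      rw [hsq]
      refine ((hv.mul hv).const_add (ξ ^ 2)).congr_deriv ?_
      have : (2 : ℝ) * Real.sqrt 2 * g * (2 * Real.sqrt 2 * h * g) + 2 * Real.sqrt 2 * h * g * (2 * Real.sqrt 2 * g) =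
          8 * (Real.sqrt 2 * Real.sqrt 2) * g ^ 2 * h := by ring
      rw [this, hs2]
      ring
    have hupos : 0 < ξ ^ 2 + (2 * Real.sqrt 2 * h * g) ^ 2 := by
      have : 2 * Real.sqrt 2 * h * g ≠ 0 := by
        have : (0 : ℝ) < Real.sqrt 2 := Real.sqrt_pos.2 (by norm_num)
        exact mul_ne_zero (mul_ne_zero (by positivity) hh) hg
      positivity
    set E : ℝ := Real.sqrt (ξ ^ 2 + (2 * Real.sqrt 2 * h * g) ^ 2) with hE
    have hEpos : 0 < E := Real.sqrt_pos.2 hupos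
    have hsqrt : HasDerivAt (fun t : ℝ => Real.sqrt (ξ ^ 2 + (2 * Real.sqrt 2 * t * g) ^ 2))
        ((16 * g ^ 2 * h) / (2 * E)) h := hu.sqrt hupos.ne'
    have hcosh : HasDerivAt (fun t : ℝ => Real.cosh (β * Real.sqrt (ξ ^ 2 + (2 * Real.sqrt 2 * t * g) ^ 2)))
        (Real.sinh (β * E) * (β * ((16 * g ^ 2 * h) / (2 * E)))) h := (hsqrt.const_mul β).cosh
    have hpos : 0 < (1 + Real.cosh (β * E)) / 2 := by
      have := Real.one_le_cosh (β * E); positivity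
    have hlog := ((hcosh.const_add 1).div_const 2).log hpos.ne'
    refine hlog.congr_deriv ?_
    simp only [← hE]
    rw [← sinh_div_one_add_cosh]
    have hc0 : 1 + Real.cosh (β * E) ≠ 0 := by have := Real.one_le_cosh (β * E); positivity
    field_simp
    ring

/-- `Re⟨Δ_d⟩ = ½ Re⟨Δ_d + Δ_d†⟩` in the Gibbs state of the (Hermitian) sourced torus. [folklore] -/
theorem re_gibbsState_pairField_eq_half (β U μ h : ℝ) :
    (gibbsState β (dWaveSourceTorus L U μ h) (pairField dWaveFormFactor L)).re =
      (gibbsState β (dWaveSourceTorus L U μ h) (pairField dWaveFormFactor L + (pairField dWaveFormFactor L)ᴴ)).re / 2 := by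
  have hH : (dWaveSourceTorus L U μ h).IsHermitian :=
    dWaveSourceTorus_isHermitian L (isHermitian_hubbardTorusWith L 1 U μ) h
  rw [map_add, gibbsState_conjTranspose β hH, Complex.add_re, Complex.star_def, Complex.conj_re]
  ring

/-- **The free Gibbs anomalous response in closed form** (`L ≥ 3`, `β > 0`, `h ≠ 0`):
`Re⟨Δ_d + Δ_d†⟩_{β, H_L(h)} = Σ_k β⁻¹ d/dh log((1 + cosh βE_k(h))/2) = Σ_k tanh(βE_k/2) · 8ĝ_d(k)²h/E_k`
(`d/dh log Z = β Re⟨Δ_d + Δ_d†⟩` against the BdG pressure `log_partitionFn_dWaveSourceTorus_zero_sub`).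
[cite: VondelftRalph2001, §4.2] -/
theorem re_gibbsState_pairSource_free (hL : 3 ≤ L) {β : ℝ} (hβ : 0 < β) (μ : ℝ) {h : ℝ} (hh : h ≠ 0) :
    (gibbsState β (dWaveSourceTorus L 0 μ h) (pairField dWaveFormFactor L + (pairField dWaveFormFactor L)ᴴ)).re =
      ∑ p : TorusSite 2 L,
        Real.tanh (β * Real.sqrt ((torusBand L p - μ) ^ 2 + (2 * Real.sqrt 2 * h * dWaveGap p) ^ 2) / 2) *
            (8 * dWaveGap p ^ 2 * h) /
          Real.sqrt ((torusBand L p - μ) ^ 2 + (2 * Real.sqrt 2 * h * dWaveGap p) ^ 2) := by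
  set H₀ := hubbardTorusWith 2 L 1 0 μ with hH₀
  set A := pairField dWaveFormFactor L + (pairField dWaveFormFactor L)ᴴ with hA
  have hHt : ∀ t : ℝ, dWaveSourceTorus L 0 μ t = H₀ - (t : ℂ) • A := fun t => rfl
  -- (1) the pressure is differentiable along the source with derivative `β Re⟨A⟩`
  have h1 : HasDerivAt (fun t : ℝ => Real.log (partitionFn β (H₀ - (t : ℂ) • A)).re)
      (β * (gibbsState β (H₀ - (h : ℂ) • A) A).re) h :=
    hasDerivAt_log_partitionFn_source (isHermitian_hubbardTorusWith L 1 0 μ)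
      (isHermitian_pairField_add_conjTranspose L) hβ h
  -- (2) the closed form, differentiated mode by mode
  have h2 : HasDerivAt (fun t : ℝ => Real.log (partitionFn β (H₀ - (t : ℂ) • A)).re)
      (∑ p : TorusSite 2 L,
        β * Real.tanh (β * Real.sqrt ((torusBand L p - μ) ^ 2 + (2 * Real.sqrt 2 * h * dWaveGap p) ^ 2) / 2) *
            (8 * dWaveGap p ^ 2 * h) /
          Real.sqrt ((torusBand L p - μ) ^ 2 + (2 * Real.sqrt 2 * h * dWaveGap p) ^ 2)) h := by
    have hF : (fun t : ℝ => Real.log (partitionFn β (H₀ - (t : ℂ) • A)).re) = fun t : ℝ =>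
        Real.log (partitionFn β (dWaveSourceTorus L 0 μ 0)).re +
          ∑ p : TorusSite 2 L,
            (Real.log ((1 + Real.cosh (β * Real.sqrt ((torusBand L p - μ) ^ 2 +
                (2 * Real.sqrt 2 * t * dWaveGap p) ^ 2))) / 2) -
              Real.log ((1 + Real.cosh (β * (torusBand L p - μ))) / 2)) := by
      funext t
      rw [← hHt, ← log_partitionFn_dWaveSourceTorus_zero_sub hL β μ t]
      ring
    rw [hF]
    refine HasDerivAt.const_add _ (HasDerivAt.fun_sum fun p _ => ?_)
    exact (hasDerivAt_log_bdgMode β (torusBand L p - μ) (dWaveGap p) hh).sub_const _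
  -- (3) uniqueness of the derivative, divided by `β`
  have h3 := h1.unique h2
  rw [← hHt] at h3
  have hβ0 : β ≠ 0 := hβ.ne'
  apply mul_left_cancel₀ hβ0
  rw [h3, Finset.mul_sum]
  refine Finset.sum_congr rfl fun p _ => ?_
  ring

omit [NeZero L] in
/-- `φ_d = 2√2 ĝ_d`: the Grassmann seed symbol is the operator form factor. [folklore] -/
theorem dWaveSymbol_eq (p : TorusSite 2 L) : dWaveSymbol L p = 2 * Real.sqrt 2 * dWaveGap p := rfl

/-- **The free Gibbs anomalous density equals the limit of the free mean-field density** (as closed forms):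
`Re⟨Δ_d⟩_{β,H_L(h)}/L² = L⁻² Σ_k hφ_d(k)² tanh(βE_k/2)/(2E_k)` (`L ≥ 3`, `β > 0`, every `h`; at `h = 0` both
vanish by `U(1)` symmetry). [folklore] -/
theorem re_gibbsState_pairField_free (hL : 3 ≤ L) {β : ℝ} (hβ : 0 < β) (μ h : ℝ) :
    (gibbsState β (dWaveSourceTorus L 0 μ h) (pairField dWaveFormFactor L)).re / (L : ℝ) ^ 2 =
      (1 / (L : ℝ) ^ 2) * ∑ p : TorusSite 2 L, h * dWaveSymbol L p ^ 2 *
        (Real.tanh (β * Real.sqrt (nambuXi L μ p ^ 2 + (h * dWaveSymbol L p) ^ 2) / 2) /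
          (2 * Real.sqrt (nambuXi L μ p ^ 2 + (h * dWaveSymbol L p) ^ 2))) := by
  by_cases hh : h = 0
  · subst hh
    rw [dWaveSourceTorus_zero, gibbsState_hubbardTorusWith_pairField L β 1 0 μ dWaveFormFactor]
    simp
  · rw [re_gibbsState_pairField_eq_half, re_gibbsState_pairSource_free hL hβ μ hh, Finset.sum_div, Finset.sum_div,
      Finset.mul_sum]
    refine Finset.sum_congr rfl fun p _ => ?_
    have hE : Real.sqrt (nambuXi L μ p ^ 2 + (h * dWaveSymbol L p) ^ 2) =
        Real.sqrt ((torusBand L p - μ) ^ 2 + (2 * Real.sqrt 2 * h * dWaveGap p) ^ 2) := by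
      rw [dWaveSymbol_eq, nambuXi]
      congr 1
      ring
    rw [hE, dWaveSymbol_eq]
    have hs2 : Real.sqrt 2 ^ 2 = 2 := Real.sq_sqrt (by norm_num)
    have hL0 : (L : ℝ) ^ 2 ≠ 0 := (cast_sq_pos_of_neZero L).ne'
    have h8 : (2 * Real.sqrt 2 * dWaveGap p) ^ 2 = 8 * dWaveGap p ^ 2 := by
      rw [mul_pow, mul_pow, hs2]; ring
    rw [h8]
    by_cases hg : dWaveGap p = 0
    · simp [hg]
    · have hEpos : 0 < Real.sqrt ((torusBand L p - μ) ^ 2 + (2 * Real.sqrt 2 * h * dWaveGap p) ^ 2) := by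
        apply Real.sqrt_pos.2
        have : 2 * Real.sqrt 2 * h * dWaveGap p ≠ 0 := by
          have : (0 : ℝ) < Real.sqrt 2 := Real.sqrt_pos.2 (by norm_num)
          exact mul_ne_zero (mul_ne_zero (by positivity) hh) hg
        positivity
      field_simp

/-! ### The bridge -/

/-- **The Matsubara bridge at `U = 0` in the bare frame.**  For `L ≥ 3`, `β > 0` and every `μ`, `h`, `Λ₀`:
`scaleMeanFieldDensityCT L M β 0 μ h 0 Λ₀ → Re⟨Δ_d⟩_{β, dWaveSourceTorus L 0 μ h}/L²` as `M → ∞` — the report's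
mean-field density coordinate converges to exactly the operator anomalous density of the free seeded torus
(no shift at `U = 0`; all other conventions agree). [folklore] -/
theorem tendsto_scaleMeanFieldDensityCT_free_bridge (hL : 3 ≤ L) {β : ℝ} (hβ : 0 < β) (μ h Λ₀ : ℝ) :
    Tendsto (fun M : ℕ => scaleMeanFieldDensityCT L M β 0 μ h 0 Λ₀) atTop
      (𝓝 ((gibbsState β (dWaveSourceTorus L 0 μ h) (pairField dWaveFormFactor L)).re / (L : ℝ) ^ 2)) := by
  rw [re_gibbsState_pairField_free hL hβ]
  exact tendsto_scaleMeanFieldDensityCT_free_zero_frame L hβ μ h Λ₀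

end Operator

/-- **The registered transfer stub at zero coupling.**  `stub_matsubaraBridge` of the crux's skeleton
(grassmann-ward-flow; same text in octave-recertification / cauchy-griffiths), instantiated at `U = 0` and the
bare frame `K' = 0` — TRUE there (its empty-shell hypotheses are not even needed); for `U ≠ 0` the same text is
false at the letter `μ` (X1) and holds with `dWaveSourceTorus L U (μ + U/2) h` on the right. [folklore] -/
theorem stub_matsubaraBridge_free_zero_frame :
    ∀ (L : ℕ) [NeZero L] (β μ h Λ' : ℝ), 3 ≤ L → 0 < β → 0 < Λ' →
      (∀ k : TorusSite 2 L, Λ' ≤ |nambuXiCT L μ 0 k|) →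
      Tendsto (fun M : ℕ => scaleMeanFieldDensityCT L M β 0 μ h 0 Λ') atTop
        (𝓝 ((Matrix.gibbsState β (dWaveSourceTorus L 0 μ h) (pairField dWaveFormFactor L)).re / (L : ℝ) ^ 2)) :=
  fun _ _ _ μ h Λ' hL hβ _ _ => tendsto_scaleMeanFieldDensityCT_free_bridge hL hβ μ h Λ'

end Summit.HubbardSuperconductivity.HubbardSuperconductivity.Theorems
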